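import Mathlib
import Literature.NumberTheory.LFunctions.ZetaScrew
import Literature.NumberTheory.LFunctions.ZetaOrdinateDictionary
import Literature.NumberTheory.LFunctions.MontgomeryZeroWindows
import Literature.Barriers.RiemannHypothesis.EpsteinZetaBatemanGrosswaldProofs
import Summits.RiemannHypothesis.RiemannHypothesis.Theorems.SoloInformedLowPart
import HarnessLib

/-!
# T43 — Verified height buys near-positivity of Suzuki's screw function `Ψ` (single-log reach)

Suzuki (J. Lond. Math. Soc. 108 (2023) = arXiv:2206.03682, Thm 1.7) proved
`RH ↔ ∀ t, Ψ(t) ≥ 0` for the explicit prime-side function `Ψ = zetaScrew`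
(`Literature.NumberTheory.LFunctions.ZetaScrew`), the diagonal `G_g(t,t)/2` of Kreĭn's screw
kernel of `ζ`; by Thm 1.1 (2) (`Suzuki2023_thm11_series`, a named fact used as a hypothesis)
`Ψ(t) = ∑_ρ m(ρ) (cosh((ρ − 1/2)t) − 1)/(ρ − 1/2)²` over the non-trivial zeros.

This file is the `Ψ`-analogue of T42 (`weilGroundEnergy_ge_neg_of_rhUpTo`): the RH-blind half of
the criterion, with its EXCHANGE RATE. A zero on the line contributes `m(1 − cos γt)/γ² ≥ 0`
(`screwTerm_re_nonneg_of_re_eq_half`); a zero of the closed strip with `|Im ρ| > T₀` contributes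
`≥ −m(1 + cosh(t/2))/(Im ρ)²` (`neg_le_screwTerm_re`); the tail `∑_{γ_n > T₀} 1/γ_n²` is
`≤ 32·C₀·log(T₀+2)/(T₀+1)` from the unit-window count `N(u+1) − N(u) ≤ C₀ log(|u|+2)`
(`Montgomery.sum_above_le`). Hence (`zetaScrew_ge_neg_of_rhUpTo`)

  `RHUpTo T₀`, `T₀ ≥ 1` ⟹ `Ψ(t) ≥ −64·C₀·(1 + cosh(t/2))·log(T₀ + 2)/(T₀ + 1)` for every `t`,

i.e. verification to height `T₀` gives `τ`-positivity of `Ψ` on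
`|t| ≤ 2 log T₀ − 2 log log T₀ − O(1)` — a SINGLE logarithm, against the double logarithm
`a ≲ log log T₀` of the Weil ground energy (T42) for the same input. Corollaries: the
absolute-constant form (`exists_zetaZeroCount_window_le`), the limit form
`∀ t τ, ∃ T₁, ∀ T₀ ≥ T₁, RHUpTo T₀ → Ψ t ≥ −τ`, and the easy half of Suzuki's
Thm 1.7 re-derived from the series: `RH → Ψ ≥ 0`.
-/

noncomputable section

open scoped Real Topology ComplexConjugate BigOperators
open Complex Filter Set Literature.NumberTheory.LFunctions

namespace Summit.RiemannHypothesis.RiemannHypothesis.Theorems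

/-- The summand of Suzuki's series (Thm 1.1 (2)) at the zero `ρ`, window parameter `t`. -/
def screwTerm (t : ℝ) (ρ : ℂ) : ℂ :=
  (riemannZetaZeroOrder ρ : ℂ) * ((Complex.cosh ((ρ - 1 / 2) * t) - 1) / (ρ - 1 / 2) ^ 2)

/-- The tail weight: `1/y²` above the verified height, `0` below. -/
def screwTailWeight (T₀ y : ℝ) : ℝ := if T₀ < |y| then 1 / y ^ 2 else 0

/-- The tail weight is non-negative. -/
theorem screwTailWeight_nonneg (T₀ y : ℝ) : 0 ≤ screwTailWeight T₀ y := by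
  unfold screwTailWeight; split_ifs <;> positivity

/-- The tail weight is even. -/
theorem screwTailWeight_neg (T₀ y : ℝ) : screwTailWeight T₀ (-y) = screwTailWeight T₀ y := by
  simp [screwTailWeight, abs_neg]

/-- **On the line the summand is non-negative**: for `Re ρ = 1/2`,
`screwTerm t ρ = m(ρ)(1 − cos(γ t))/γ²` (`γ = Im ρ`), a non-negative real. -/
theorem screwTerm_re_nonneg_of_re_eq_half {ρ : ℂ} (hre : ρ.re = 1 / 2)
    (hm : 0 ≤ riemannZetaZeroOrder ρ) (t : ℝ) : 0 ≤ (screwTerm t ρ).re := by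
  have eρ : ρ - 1 / 2 = (ρ.im : ℂ) * I := by
    apply Complex.ext <;> simp [hre]
  have hcosh : Complex.cosh ((ρ - 1 / 2) * t) = (Real.cos (ρ.im * t) : ℂ) := by
    rw [eρ, show (ρ.im : ℂ) * I * t = ((ρ.im * t : ℝ) : ℂ) * I by push_cast; ring,
      Complex.cosh_mul_I, ← Complex.ofReal_cos]
  have hsq : (ρ - 1 / 2) ^ 2 = ((-(ρ.im ^ 2) : ℝ) : ℂ) := by
    rw [eρ]; push_cast; rw [mul_pow, Complex.I_sq]; ring
  have hval : screwTerm t ρ = (((riemannZetaZeroOrder ρ : ℝ) *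
      ((Real.cos (ρ.im * t) - 1) / (-(ρ.im ^ 2)))) : ℝ) := by
    rw [screwTerm, hcosh, hsq]; push_cast; ring
  rw [hval, Complex.ofReal_re]
  have hm' : (0 : ℝ) ≤ riemannZetaZeroOrder ρ := by exact_mod_cast hm
  apply mul_nonneg hm'
  by_cases hy : ρ.im = 0
  · simp [hy]
  · have hcos : Real.cos (ρ.im * t) ≤ 1 := Real.cos_le_one _
    have hy2 : 0 < ρ.im ^ 2 := by positivity
    rw [div_neg, ← neg_div, neg_sub]
    exact div_nonneg (by linarith) hy2.le

/-- **In the strip the summand is at least `−m(1 + cosh(t/2))/(Im ρ)²`** (`0 ≤ Re ρ ≤ 1`). -/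
theorem neg_le_screwTerm_re {ρ : ℂ} (h0 : 0 ≤ ρ.re) (h1 : ρ.re ≤ 1) (him : ρ.im ≠ 0)
    (hm : 0 ≤ riemannZetaZeroOrder ρ) (t : ℝ) :
    -((riemannZetaZeroOrder ρ : ℝ) * ((1 + Real.cosh (t / 2)) / ρ.im ^ 2)) ≤
      (screwTerm t ρ).re := by
  have hm' : (0 : ℝ) ≤ riemannZetaZeroOrder ρ := by exact_mod_cast hm
  -- `Re z ≥ -‖z‖`
  refine le_trans ?_ (neg_le.1 (neg_le_abs _ |>.trans (Complex.abs_re_le_norm _)))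
  rw [neg_le_neg_iff, screwTerm, norm_mul]
  have hnm : ‖(riemannZetaZeroOrder ρ : ℂ)‖ = (riemannZetaZeroOrder ρ : ℝ) := by
    rw [← Complex.ofReal_intCast, Complex.norm_real, Real.norm_eq_abs, abs_of_nonneg hm']
  rw [hnm]
  refine mul_le_mul_of_nonneg_left ?_ hm'
  rw [norm_div, norm_pow]
  -- numerator
  have hnum : ‖Complex.cosh ((ρ - 1 / 2) * t) - 1‖ ≤ 1 + Real.cosh (t / 2) := by
    have hre : ((ρ - 1 / 2) * t).re = (ρ.re - 1 / 2) * t := by simp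
    have hc : Real.cosh (((ρ - 1 / 2) * t).re) ≤ Real.cosh (t / 2) := by
      rw [hre, Real.cosh_le_cosh, abs_mul]
      have : |ρ.re - 1 / 2| ≤ 1 / 2 := abs_le.2 ⟨by linarith, by linarith⟩
      calc |ρ.re - 1 / 2| * |t| ≤ 1 / 2 * |t| := by gcongr
        _ = |t / 2| := by rw [abs_div]; norm_num; ring
    calc ‖Complex.cosh ((ρ - 1 / 2) * t) - 1‖
        ≤ ‖Complex.cosh ((ρ - 1 / 2) * t)‖ + ‖(1 : ℂ)‖ := norm_sub_le _ _
      _ ≤ Real.cosh (t / 2) + 1 := by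
          rw [norm_one]; exact add_le_add
            ((Literature.Barriers.RiemannHypothesis.norm_ccosh_le_cosh_re _).trans hc) le_rfl
      _ = 1 + Real.cosh (t / 2) := add_comm _ _
  -- denominator
  have hden : ρ.im ^ 2 ≤ ‖ρ - 1 / 2‖ ^ 2 := by
    have h := Complex.abs_im_le_norm (ρ - 1 / 2)
    have e : (ρ - 1 / 2).im = ρ.im := by simp
    rw [e] at h
    nlinarith [abs_nonneg ρ.im, sq_abs ρ.im]
  have hden0 : 0 < ρ.im ^ 2 := by positivity
  calc ‖Complex.cosh ((ρ - 1 / 2) * t) - 1‖ / ‖ρ - 1 / 2‖ ^ 2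
      ≤ (1 + Real.cosh (t / 2)) / ‖ρ - 1 / 2‖ ^ 2 := by gcongr
    _ ≤ (1 + Real.cosh (t / 2)) / ρ.im ^ 2 := by
        apply div_le_div_of_nonneg_left (by positivity) hden0 hden

/-- **Tail of `∑ 1/γ_n²` above `T₀`** from the unit-window count: for any finite set of indices
with `γ_n > T₀ ≥ 1`, `∑ 1/γ_n² ≤ 32·C₀·log(T₀+2)/(T₀+1)`. -/
theorem sum_inv_sq_zetaOrdinate_le {C₀ : ℝ} (hC₀ : 0 ≤ C₀)
    (hW : ∀ u : ℝ, (zetaZeroCount (u + 1) : ℝ) - zetaZeroCount u ≤ C₀ * Real.log (|u| + 2))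
    {T₀ : ℝ} (hT₀ : 1 ≤ T₀) (s : Finset ℕ) (hs : ∀ n ∈ s, T₀ < zetaOrdinate n) :
    ∑ n ∈ s, 1 / zetaOrdinate n ^ 2 ≤ 32 * C₀ * Real.log (T₀ + 2) / (T₀ + 1) := by
  have hT₀0 : 0 ≤ T₀ := by linarith
  have h := Montgomery.sum_above_le hC₀ hW s hT₀0 hT₀0 hs
  simp only [sub_add_cancel] at h
  have hpt : ∀ n ∈ s, 1 / zetaOrdinate n ^ 2 ≤ 2 * (1 / (1 + zetaOrdinate n ^ 2)) := by
    intro n hn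
    have hγ : 1 ≤ zetaOrdinate n := hT₀.trans (hs n hn).le
    have hγ2 : 1 ≤ zetaOrdinate n ^ 2 := by nlinarith
    rw [mul_one_div, div_le_div_iff₀ (by positivity) (by positivity)]
    nlinarith
  calc ∑ n ∈ s, 1 / zetaOrdinate n ^ 2
      ≤ ∑ n ∈ s, 2 * (1 / (1 + zetaOrdinate n ^ 2)) := Finset.sum_le_sum hpt
    _ = 2 * ∑ n ∈ s, 1 / (1 + zetaOrdinate n ^ 2) := by rw [Finset.mul_sum]
    _ ≤ 2 * (C₀ * (4 * Real.log (T₀ + 2) + 12 * Real.log (T₀ + 2)) / (T₀ + 1)) := by gcongr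
    _ = 32 * C₀ * Real.log (T₀ + 2) / (T₀ + 1) := by ring

/-- The tail bound transported to the truncated zero sums over the zero set:
`∑_{|Im ρ| ≤ T} m(ρ)·w_{T₀}(Im ρ) ≤ 64·C₀·log(T₀+2)/(T₀+1)` for every `T`. -/
theorem sum_weilZeroFinset_screwTailWeight_le {C₀ : ℝ} (hC₀ : 0 ≤ C₀)
    (hW : ∀ u : ℝ, (zetaZeroCount (u + 1) : ℝ) - zetaZeroCount u ≤ C₀ * Real.log (|u| + 2))
    {T₀ : ℝ} (hT₀ : 1 ≤ T₀) (T : ℝ) :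
    ∑ ρ ∈ weilZeroFinset T, (riemannZetaZeroOrder (ρ : ℂ) : ℝ) * screwTailWeight T₀ (ρ : ℂ).im
      ≤ 64 * C₀ * Real.log (T₀ + 2) / (T₀ + 1) := by
  classical
  have hC := OrdinateDictionary.sum_weilZeroFinset_mul_eq_sum_range
    (fun y ↦ ((screwTailWeight T₀ y : ℝ) : ℂ)) T
  have hR : ((∑ ρ ∈ weilZeroFinset T,
      (riemannZetaZeroOrder (ρ : ℂ) : ℝ) * screwTailWeight T₀ (ρ : ℂ).im : ℝ) : ℂ) =
      ((∑ n ∈ Finset.range (zetaZeroCount T),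
        (screwTailWeight T₀ (zetaOrdinate n) + screwTailWeight T₀ (-zetaOrdinate n)) : ℝ) : ℂ) := by
    push_cast
    convert hC using 2 with ρ
  have hRR := Complex.ofReal_injective hR
  rw [hRR]
  simp_rw [screwTailWeight_neg, ← two_mul, ← Finset.mul_sum]
  -- the inner sum is over indices with `γ_n > T₀` (the weight vanishes elsewhere)
  have hpos : ∀ n : ℕ, 0 < zetaOrdinate n := zetaOrdinate_pos_holds
  set s := (Finset.range (zetaZeroCount T)).filter (fun n ↦ T₀ < zetaOrdinate n) with hs
  have hsplit : ∑ n ∈ Finset.range (zetaZeroCount T), screwTailWeight T₀ (zetaOrdinate n) =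
      ∑ n ∈ s, 1 / zetaOrdinate n ^ 2 := by
    rw [hs, Finset.sum_filter]
    refine Finset.sum_congr rfl fun n _ ↦ ?_
    unfold screwTailWeight
    rw [abs_of_pos (hpos n)]
  rw [hsplit]
  have hmem : ∀ n ∈ s, T₀ < zetaOrdinate n := fun n hn ↦ (Finset.mem_filter.1 hn).2
  have h := sum_inv_sq_zetaOrdinate_le hC₀ hW hT₀ s hmem
  calc 2 * ∑ n ∈ s, 1 / zetaOrdinate n ^ 2 ≤ 2 * (32 * C₀ * Real.log (T₀ + 2) / (T₀ + 1)) := by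
        gcongr
    _ = 64 * C₀ * Real.log (T₀ + 2) / (T₀ + 1) := by ring

/-- Summability of the tail majorant over the zero set, with the bound on its sum. -/
theorem summable_screwTailWeight {C₀ : ℝ} (hC₀ : 0 ≤ C₀)
    (hW : ∀ u : ℝ, (zetaZeroCount (u + 1) : ℝ) - zetaZeroCount u ≤ C₀ * Real.log (|u| + 2))
    {T₀ : ℝ} (hT₀ : 1 ≤ T₀) :
    (Summable fun ρ : ZetaZeros.riemannZetaNontrivialZeros ↦
        (riemannZetaZeroOrder (ρ : ℂ) : ℝ) * screwTailWeight T₀ (ρ : ℂ).im) ∧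
      ∑' ρ : ZetaZeros.riemannZetaNontrivialZeros,
        (riemannZetaZeroOrder (ρ : ℂ) : ℝ) * screwTailWeight T₀ (ρ : ℂ).im
          ≤ 64 * C₀ * Real.log (T₀ + 2) / (T₀ + 1) := by
  set f : ZetaZeros.riemannZetaNontrivialZeros → ℝ :=
    fun ρ ↦ (riemannZetaZeroOrder (ρ : ℂ) : ℝ) * screwTailWeight T₀ (ρ : ℂ).im with hf
  have hf0 : ∀ ρ, 0 ≤ f ρ := fun ρ ↦ by
    have hm : (0 : ℝ) ≤ riemannZetaZeroOrder (ρ : ℂ) := by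
      exact_mod_cast riemannZetaZeroOrder_nonneg
        (ZetaZeros.riemannZetaNontrivialZeros.ne_one ρ.2)
    exact mul_nonneg hm (screwTailWeight_nonneg _ _)
  have hbd : ∀ u : Finset ZetaZeros.riemannZetaNontrivialZeros,
      ∑ ρ ∈ u, f ρ ≤ 64 * C₀ * Real.log (T₀ + 2) / (T₀ + 1) := by
    intro u
    obtain ⟨T, hT⟩ := (tendsto_atTop.1 tendsto_weilZeroFinset u).exists
    calc ∑ ρ ∈ u, f ρ ≤ ∑ ρ ∈ weilZeroFinset T, f ρ :=
          Finset.sum_le_sum_of_subset_of_nonneg hT fun ρ _ _ ↦ hf0 ρ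
      _ ≤ _ := sum_weilZeroFinset_screwTailWeight_le hC₀ hW hT₀ T
  exact ⟨summable_of_sum_le hf0 hbd, Real.tsum_le_of_sum_le hf0 hbd⟩

/-- **T43 (verified height buys near-positivity of `Ψ`, single-log reach).**
Under `RHUpTo T₀` (`T₀ ≥ 1`), the unit-window count with constant `C₀` and Suzuki's series
(Thm 1.1 (2)): `Ψ(t) ≥ −64·C₀·(1 + cosh(t/2))·log(T₀+2)/(T₀+1)` for every real `t`. -/
theorem zetaScrew_ge_neg_of_rhUpTo (hS : Suzuki2023_thm11_series) {C₀ : ℝ} (hC₀ : 0 ≤ C₀)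
    (hW : ∀ u : ℝ, (zetaZeroCount (u + 1) : ℝ) - zetaZeroCount u ≤ C₀ * Real.log (|u| + 2))
    {T₀ : ℝ} (hT₀ : 1 ≤ T₀) (hRH : RHUpTo T₀) (t : ℝ) :
    -(64 * C₀ * (1 + Real.cosh (t / 2)) * Real.log (T₀ + 2) / (T₀ + 1)) ≤ zetaScrew t := by
  obtain ⟨hsum, htsum⟩ := summable_screwTailWeight hC₀ hW hT₀
  set S : ℝ := ∑' ρ : ZetaZeros.riemannZetaNontrivialZeros,
    (riemannZetaZeroOrder (ρ : ℂ) : ℝ) * screwTailWeight T₀ (ρ : ℂ).im with hSdef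
  have hK0 : 0 ≤ 1 + Real.cosh (t / 2) := by positivity
  -- real parts of Suzuki's series
  have h1 : HasSum (fun ρ : ZetaZeros.riemannZetaNontrivialZeros ↦ (screwTerm t ρ).re)
      (zetaScrew t) := by
    have h := (hS t).mapL Complex.reCLM
    simpa [screwTerm] using h
  -- the majorant series
  have h2 : HasSum (fun ρ : ZetaZeros.riemannZetaNontrivialZeros ↦
      -((1 + Real.cosh (t / 2)) *
        ((riemannZetaZeroOrder (ρ : ℂ) : ℝ) * screwTailWeight T₀ (ρ : ℂ).im)))
      (-((1 + Real.cosh (t / 2)) * S)) :=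
    (hsum.hasSum.mul_left _).neg
  -- pointwise comparison
  have hpt : ∀ ρ : ZetaZeros.riemannZetaNontrivialZeros,
      -((1 + Real.cosh (t / 2)) *
        ((riemannZetaZeroOrder (ρ : ℂ) : ℝ) * screwTailWeight T₀ (ρ : ℂ).im))
        ≤ (screwTerm t ρ).re := by
    intro ρ
    have hz := ZetaZeros.riemannZetaNontrivialZeros.zeta_eq_zero ρ.2
    have hre0 := ZetaZeros.riemannZetaNontrivialZeros.re_pos ρ.2
    have hre1 := ZetaZeros.riemannZetaNontrivialZeros.re_lt_one ρ.2
    have him := ZetaZeros.riemannZetaNontrivialZeros.im_ne_zero ρ.2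
    have hm : 0 ≤ riemannZetaZeroOrder (ρ : ℂ) :=
      riemannZetaZeroOrder_nonneg (ZetaZeros.riemannZetaNontrivialZeros.ne_one ρ.2)
    by_cases hγ : T₀ < |(ρ : ℂ).im|
    · have hw : screwTailWeight T₀ (ρ : ℂ).im = 1 / (ρ : ℂ).im ^ 2 := by
        simp [screwTailWeight, hγ]
      rw [hw]
      have h := neg_le_screwTerm_re hre0.le hre1.le him hm t
      calc -((1 + Real.cosh (t / 2)) * ((riemannZetaZeroOrder (ρ : ℂ) : ℝ) * (1 / (ρ : ℂ).im ^ 2)))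
          = -((riemannZetaZeroOrder (ρ : ℂ) : ℝ) * ((1 + Real.cosh (t / 2)) / (ρ : ℂ).im ^ 2)) := by
            ring
        _ ≤ _ := h
    · have hw : screwTailWeight T₀ (ρ : ℂ).im = 0 := by simp [screwTailWeight, hγ]
      rw [hw, mul_zero, mul_zero, neg_zero]
      exact screwTerm_re_nonneg_of_re_eq_half (hRH.re_eq hz him (not_lt.1 hγ)) hm t
  have hle := hasSum_le hpt h2 h1
  have hS' : (1 + Real.cosh (t / 2)) * S ≤
      (1 + Real.cosh (t / 2)) * (64 * C₀ * Real.log (T₀ + 2) / (T₀ + 1)) :=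
    mul_le_mul_of_nonneg_left htsum hK0
  calc -(64 * C₀ * (1 + Real.cosh (t / 2)) * Real.log (T₀ + 2) / (T₀ + 1))
      = -((1 + Real.cosh (t / 2)) * (64 * C₀ * Real.log (T₀ + 2) / (T₀ + 1))) := by ring
    _ ≤ -((1 + Real.cosh (t / 2)) * S) := by linarith
    _ ≤ zetaScrew t := hle

/-- **T43, absolute-constant form.** There is `C > 0` with: for every `T₀ ≥ 1`, `RHUpTo T₀` and
Suzuki's series give `Ψ(t) ≥ −C·(1 + cosh(t/2))·log(T₀+2)/(T₀+1)` for all `t`. -/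
theorem exists_zetaScrew_ge_neg_of_rhUpTo :
    ∃ C : ℝ, 0 < C ∧ ∀ T₀ : ℝ, 1 ≤ T₀ → RHUpTo T₀ → Suzuki2023_thm11_series → ∀ t : ℝ,
      -(C * (1 + Real.cosh (t / 2)) * Real.log (T₀ + 2) / (T₀ + 1)) ≤ zetaScrew t := by
  obtain ⟨C₀, hC₀, hW⟩ := Montgomery.exists_zetaZeroCount_window_le
  refine ⟨64 * C₀, by positivity, fun T₀ hT₀ hRH hS t ↦ ?_⟩
  have h := zetaScrew_ge_neg_of_rhUpTo hS hC₀.le hW hT₀ hRH t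
  convert h using 2

/-- **T43, limit form (no amplification, but full recovery in the limit).** For every `t` and
`τ > 0` there is `T₁` such that verification to any height `T₀ ≥ T₁` gives `Ψ(t) ≥ −τ`. -/
theorem zetaScrew_ge_neg_eventually (hS : Suzuki2023_thm11_series) (t τ : ℝ) (hτ : 0 < τ) :
    ∃ T₁ : ℝ, ∀ T₀ : ℝ, T₁ ≤ T₀ → RHUpTo T₀ → -τ ≤ zetaScrew t := by
  obtain ⟨C, hC, hmain⟩ := exists_zetaScrew_ge_neg_of_rhUpTo
  set K : ℝ := C * (1 + Real.cosh (t / 2)) with hK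
  have hK0 : 0 < K := by positivity
  -- `log(T₀+2)/(T₀+1) → 0`
  have hlim : Tendsto (fun T₀ : ℝ ↦ Real.log (T₀ + 2) / (T₀ + 1)) atTop (𝓝 0) := by
    have h1 : Tendsto (fun x : ℝ ↦ Real.log x / x) atTop (𝓝 0) := by
      simpa using Real.tendsto_pow_log_div_mul_add_atTop 1 0 1 one_ne_zero
    have h2 : Tendsto (fun T₀ : ℝ ↦ Real.log (T₀ + 2) / (T₀ + 2)) atTop (𝓝 0) :=
      h1.comp (tendsto_atTop_add_const_right _ _ tendsto_id)
    have h3 : Tendsto (fun T₀ : ℝ ↦ (T₀ + 2) / (T₀ + 1)) atTop (𝓝 1) := by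
      have : Tendsto (fun T₀ : ℝ ↦ 1 + 1 / (T₀ + 1)) atTop (𝓝 (1 + 0)) :=
        tendsto_const_nhds.add (tendsto_const_nhds.div_atTop
          (tendsto_atTop_add_const_right _ _ tendsto_id))
      rw [add_zero] at this
      refine this.congr' ?_
      filter_upwards [eventually_gt_atTop 0] with x hx
      field_simp; ring
    have h4 := h2.mul h3
    rw [zero_mul] at h4
    refine h4.congr' ?_
    filter_upwards [eventually_gt_atTop 0] with x hx
    field_simp
  have hev : ∀ᶠ T₀ : ℝ in atTop, K * (Real.log (T₀ + 2) / (T₀ + 1)) < τ := by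
    have := (hlim.const_mul K)
    rw [mul_zero] at this
    exact this.eventually (gt_mem_nhds hτ)
  obtain ⟨T₂, hT₂⟩ := eventually_atTop.1 hev
  refine ⟨max T₂ 1, fun T₀ hT₀ hRH ↦ ?_⟩
  have h1 : 1 ≤ T₀ := (le_max_right _ _).trans hT₀
  have h := hmain T₀ h1 hRH hS t
  have hlt := hT₂ T₀ ((le_max_left _ _).trans hT₀)
  have e : C * (1 + Real.cosh (t / 2)) * Real.log (T₀ + 2) / (T₀ + 1) =
      K * (Real.log (T₀ + 2) / (T₀ + 1)) := by rw [hK]; ring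
  rw [e] at h
  linarith

/-- **The easy half of Suzuki's Thm 1.7 from the series**: `RH → Ψ ≥ 0`. -/
theorem zetaScrew_nonneg_of_riemannHypothesis (hS : Suzuki2023_thm11_series)
    (hRH : RiemannHypothesis) (t : ℝ) : 0 ≤ zetaScrew t := by
  by_contra h
  push Not at h
  obtain ⟨T₁, hT₁⟩ := zetaScrew_ge_neg_eventually hS t (-zetaScrew t / 2) (by linarith)
  have := hT₁ T₁ le_rfl (rhUpTo_of_riemannHypothesis hRH T₁)
  linarith

/-- **Platt–Trudgian instance** (`T₀ = 3 000 175 332 800`). -/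
theorem zetaScrew_ge_neg_of_platt_trudgian (hS : Suzuki2023_thm11_series)
    (hPT : platt_trudgian_numerical_rh) {C₀ : ℝ} (hC₀ : 0 ≤ C₀)
    (hW : ∀ u : ℝ, (zetaZeroCount (u + 1) : ℝ) - zetaZeroCount u ≤ C₀ * Real.log (|u| + 2))
    (t : ℝ) :
    -(64 * C₀ * (1 + Real.cosh (t / 2)) * Real.log (3000175332800 + 2) / (3000175332800 + 1))
      ≤ zetaScrew t :=
  zetaScrew_ge_neg_of_rhUpTo hS hC₀ hW (by norm_num) (rhUpTo_of_platt_trudgian hPT) t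

end Summit.RiemannHypothesis.RiemannHypothesis.Theorems
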